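/-
Copyright: the b2b-balaban T⁴-continuum CRUX team, row NE7b OWNER lineage `t4-ne7b-p1` (gen 141). Project licence.
-/
import Summits.QuantumFields.BalabanUV.T4Continuum.Spine.NE7b.SupBlockThirdCentredGeneral

/-!
# THE CENTRED DISPLAY OF `∂³W` SPLITS INTO FIVE TILTED PIECES, GENERAL `Γ ⪰ 0` (SCOPING (d12)(1)(iv), first half).  (472)'s display
#   `T(ψ)[h,k,l] = Z⁻¹∫e^{−U}[C − (A_k−a_k)B_hl − B_hk(A_l−a_l) − (A_h−a_h)B_kl + (A_h−a_h)(A_k−a_k)(A_l−a_l)] dN(0,Γ)`   (`a_v = Z⁻¹∫e^{−U}A_v`)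
# equals `⟨C⟩ − Cov(B_hl,A_k) − Cov(B_hk,A_l) − Cov(A_h,B_kl) + κ₃(A_h,A_k,A_l)`, each covariance written in (469)∕(473)'s tilted format
# `Z⁻¹∫e·XY − Z⁻²(∫e·X)(∫e·Y)` and the cumulant as `Z⁻¹∫e·Π(A−a)` — the algebraic step between the centred display and the kernel letters
# of the pieces ((470) average, (469)∕(473) two-point, (468) cumulant), which the next file assembles for `Γ = AAᵀ` (row NE7b, node U5c;
# (472), (403) BY NAME; [folklore])

Cell `pub-balaban`, sub-cell `t4`, spine estimate NE7b (`T4WeightBudget.RelWeightBound`; the cell's OWN estimate — NOT PRINTED in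
[Bałaban 1983–89], NOT PROVED).  Crux-route work under `Spine/NE7b/` by the row OWNER (`t4-ne7b-p1` gen 141, file (474)) under FREEZE
(0)'s crux-prover clause; NOTHING of Bałaban's is named as a Lean object, valued or asserted; no `T4Continuum/Support` leaf typed; no
`def`, no notation; zero `sorry`.  Imports (BY NAME): the OWNER's (472) `…SupBlockThirdCentredGeneral` (`integrable_scalar_pieces`; through
it (471), (419), (423) `integrable_block_moments`, (403) `integrable_weighted_blockDeriv_apply`, (401) `integrable_exp_neg_block`).

WHAT IS PROVED ([folklore]; general `Γ ⪰ 0` with the operator letter `Γ ⪯ γ_op·1` and the regulator `(2κ₀(1+τ)+4δ)γ_op ≤ θ < 1`):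
* §1 `integrable_centred_triple` (`e·(A_h−c_h)(A_k−c_k)(A_l−c_l) ∈ L¹(N(0,Γ))` for ANY centring constants, by expansion into (472)'s
  scalar pieces), THE END **`centred_split`**; §2 toy.

HONEST (what this is NOT).  Linearity of the integral, nothing more; the assembly with the five kernel letters is the next file (475);
scalar skeleton ((A3), NC-NE7b-α UNRULED); nothing of Bałaban's asserted.  BY-NAME EFFECT ON THE WALL: NONE.  NE7b NOT PRINTED ∕ NOT
PROVED; spine PROVED 0∕9; rung (B)+1 — the programme's measures remain FINITE-torus statements; NOT the mass gap, NOT Clay.  HONEST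
DEPENDENCY: continuum YM on T⁴ ⇐ BetaPertH ∧ nine spine estimates (0∕9 proved); BetaPertH ⇐ (D1) ∧ (D4) ∧ CAP+tail; G-an2-4 gates asym,
D1 and NE2∕3∕4.
-/

set_option autoImplicit false
set_option maxSynthPendingDepth 3

noncomputable section

namespace Summit.QuantumFields.BalabanUV.T4Continuum.NE7b.SupBlockThirdCentredSplit

open MeasureTheory ProbabilityTheory Finset Real
open scoped BigOperators Matrix
open SupEffectiveActionDerivative (mul_opBound_le_of_le)
open SupBlockEffectiveActionDerivative (integrable_exp_neg_block)
open SupBlockUpperLetter (integrable_weighted_blockDeriv_apply)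
open SupBlockThirdCentredGeneral (integrable_scalar_pieces)

variable {ι : Type} [Fintype ι] [DecidableEq ι]

/-! ## §1. The centred triple product; the split -/

section Split

variable {Γ : Matrix ι ι ℝ} {γop : ℝ} {U : EuclideanSpace ℝ ι → ℝ} {U' : EuclideanSpace ℝ ι → EuclideanSpace ℝ ι →L[ℝ] ℝ}
  {U'' : EuclideanSpace ℝ ι → EuclideanSpace ℝ ι →L[ℝ] EuclideanSpace ℝ ι →L[ℝ] ℝ}
  {U₃ : EuclideanSpace ℝ ι → EuclideanSpace ℝ ι →L[ℝ] EuclideanSpace ℝ ι →L[ℝ] EuclideanSpace ℝ ι →L[ℝ] ℝ} {κ₀ κ₁ κ₂ κ₃ a τ δ θp : ℝ}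

/-- **The centred triple product is integrable** against `e^{−U(ω+ψ)}dN(0,Γ)`, for any centring constants (expansion into (472)'s scalar
pieces `e·AAA`, `e·AA`, (403)'s `e·A` and (401)'s `e`). [folklore] -/
theorem integrable_centred_triple (hΓ : Γ.PosSemidef) (hΓop : (γop • (1 : Matrix ι ι ℝ) - Γ).PosSemidef) (Y : Finset ι)
    (hUd : ∀ φ : EuclideanSpace ℝ ι, HasFDerivAt U (U' φ) φ) (hU'd : ∀ φ : EuclideanSpace ℝ ι, HasFDerivAt U' (U'' φ) φ)
    (hU''d : ∀ φ : EuclideanSpace ℝ ι, HasFDerivAt U'' (U₃ φ) φ) (hU₃c : Continuous U₃) (hκ₀ : 0 ≤ κ₀) (hκ₁ : 0 ≤ κ₁) (ha : 0 ≤ a) (hτ : 0 < τ) (hδ :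
        0 < δ)
    (hθ0 : 0 < θp) (hθ1 : θp < 1) (hκθ : (2 * κ₀ * (1 + τ) + 4 * δ) * γop ≤ θp) (hstab : ∀ φ : EuclideanSpace ℝ ι, -(κ₀ * ∑ x ∈ Y, φ x ^ 2) ≤ U φ)
    (hU'b : ∀ φ : EuclideanSpace ℝ ι, ‖U' φ‖ ≤ κ₁ * (a + ∑ x ∈ Y, φ x ^ 2)) (hU''b : ∀ φ : EuclideanSpace ℝ ι, ‖U'' φ‖ ≤ κ₂)
    (hU₃b : ∀ φ : EuclideanSpace ℝ ι, ‖U₃ φ‖ ≤ κ₃) (ψ h k l : EuclideanSpace ℝ ι) (ch ck cl : ℝ) :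
    Integrable (fun ω : EuclideanSpace ℝ ι => exp (-U (ω + ψ)) * ((U' (ω + ψ) h - ch) * (U' (ω + ψ) k - ck) * (U' (ω + ψ) l - cl)))
        (multivariateGaussian 0 Γ) := by
  have hU'c : Continuous U' := continuous_iff_continuousAt.2 fun φ => (hU'd φ).continuousAt
  have hUc : Continuous U := continuous_iff_continuousAt.2 fun φ => (hUd φ).continuousAt
  have hκθ₀ : 2 * κ₀ * (1 + τ) * γop ≤ θp := mul_opBound_le_of_le (by positivity) (by linarith) hθ0.le hκθ
  have hI := integrable_exp_neg_block hΓ hΓop Y hUc.measurable hκ₀ hτ hθ1 hκθ₀ hstab ψ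
  have iA : ∀ v : EuclideanSpace ℝ ι, Integrable (fun ω : EuclideanSpace ℝ ι => exp (-U (ω + ψ)) * U' (ω + ψ) v) (multivariateGaussian 0 Γ) := fun v
      =>
    integrable_weighted_blockDeriv_apply hΓ hΓop Y hUd hU'c hκ₀ hκ₁ ha hτ hδ hθ1 hκθ hstab hU'b ψ v
  obtain ⟨-, -, -, -, iAA, iAAA⟩ := integrable_scalar_pieces hΓ hΓop Y hUd hU'd hU''d hU₃c hκ₀ hκ₁ ha hτ hδ hθ0 hθ1 hκθ hstab hU'b hU''b hU₃b ψ h k l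
  have q1 : Integrable (fun ω : EuclideanSpace ℝ ι => exp (-U (ω + ψ)) * (U' (ω + ψ) h * U' (ω + ψ) k * U' (ω + ψ) l) - ch * (exp (-U (ω + ψ)) * (U'
      (ω + ψ) k *
      U' (ω + ψ) l))) (multivariateGaussian 0 Γ) := iAAA.sub ((iAA k l).const_mul ch)
  have q2 : Integrable (fun ω : EuclideanSpace ℝ ι => exp (-U (ω + ψ)) * (U' (ω + ψ) h * U' (ω + ψ) k * U' (ω + ψ) l) - ch * (exp (-U (ω + ψ)) * (U'
      (ω + ψ) k *
      U' (ω + ψ) l)) - ck * (exp (-U (ω + ψ)) * (U' (ω + ψ) h * U' (ω + ψ) l))) (multivariateGaussian 0 Γ) := q1.sub ((iAA h l).const_mul ck)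
  have q3 : Integrable (fun ω : EuclideanSpace ℝ ι => exp (-U (ω + ψ)) * (U' (ω + ψ) h * U' (ω + ψ) k * U' (ω + ψ) l) - ch * (exp (-U (ω + ψ)) * (U'
      (ω + ψ) k *
      U' (ω + ψ) l)) - ck * (exp (-U (ω + ψ)) * (U' (ω + ψ) h * U' (ω + ψ) l)) - cl * (exp (-U (ω + ψ)) * (U' (ω + ψ) h * U' (ω + ψ) k)))
          (multivariateGaussian 0 Γ) :=
    q2.sub ((iAA h k).const_mul cl)
  have q4 : Integrable (fun ω : EuclideanSpace ℝ ι => exp (-U (ω + ψ)) * (U' (ω + ψ) h * U' (ω + ψ) k * U' (ω + ψ) l) - ch * (exp (-U (ω + ψ)) * (U'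
      (ω + ψ) k *
      U' (ω + ψ) l)) - ck * (exp (-U (ω + ψ)) * (U' (ω + ψ) h * U' (ω + ψ) l)) - cl * (exp (-U (ω + ψ)) * (U' (ω + ψ) h * U' (ω + ψ) k)) + ch * ck *
          (exp (-U (ω + ψ)) *
      U' (ω + ψ) l)) (multivariateGaussian 0 Γ) := q3.add ((iA l).const_mul _)
  have q5 : Integrable (fun ω : EuclideanSpace ℝ ι => exp (-U (ω + ψ)) * (U' (ω + ψ) h * U' (ω + ψ) k * U' (ω + ψ) l) - ch * (exp (-U (ω + ψ)) * (U'
      (ω + ψ) k *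
      U' (ω + ψ) l)) - ck * (exp (-U (ω + ψ)) * (U' (ω + ψ) h * U' (ω + ψ) l)) - cl * (exp (-U (ω + ψ)) * (U' (ω + ψ) h * U' (ω + ψ) k)) + ch * ck *
          (exp (-U (ω + ψ)) *
      U' (ω + ψ) l) + ch * cl * (exp (-U (ω + ψ)) * U' (ω + ψ) k)) (multivariateGaussian 0 Γ) := q4.add ((iA k).const_mul _)
  have q6 : Integrable (fun ω : EuclideanSpace ℝ ι => exp (-U (ω + ψ)) * (U' (ω + ψ) h * U' (ω + ψ) k * U' (ω + ψ) l) - ch * (exp (-U (ω + ψ)) * (U'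
      (ω + ψ) k *
      U' (ω + ψ) l)) - ck * (exp (-U (ω + ψ)) * (U' (ω + ψ) h * U' (ω + ψ) l)) - cl * (exp (-U (ω + ψ)) * (U' (ω + ψ) h * U' (ω + ψ) k)) + ch * ck *
          (exp (-U (ω + ψ)) *
      U' (ω + ψ) l) + ch * cl * (exp (-U (ω + ψ)) * U' (ω + ψ) k) + ck * cl * (exp (-U (ω + ψ)) * U' (ω + ψ) h)) (multivariateGaussian 0 Γ) := q5.add
          ((iA h).const_mul _)
  have q7 : Integrable (fun ω : EuclideanSpace ℝ ι => exp (-U (ω + ψ)) * (U' (ω + ψ) h * U' (ω + ψ) k * U' (ω + ψ) l) - ch * (exp (-U (ω + ψ)) * (U'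
      (ω + ψ) k *
      U' (ω + ψ) l)) - ck * (exp (-U (ω + ψ)) * (U' (ω + ψ) h * U' (ω + ψ) l)) - cl * (exp (-U (ω + ψ)) * (U' (ω + ψ) h * U' (ω + ψ) k)) + ch * ck *
          (exp (-U (ω + ψ)) *
      U' (ω + ψ) l) + ch * cl * (exp (-U (ω + ψ)) * U' (ω + ψ) k) + ck * cl * (exp (-U (ω + ψ)) * U' (ω + ψ) h) - ch * ck * cl * exp (-U (ω + ψ)))
          (multivariateGaussian 0 Γ) :=
    q6.sub (hI.const_mul _)
  exact q7.congr (ae_of_all _ fun ω => by ring)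

/-- **THE CENTRED DISPLAY SPLITS INTO FIVE TILTED PIECES**: average, three two-point covariances (each in (469)∕(473)'s
`Z⁻¹∫e·XY − Z⁻²(∫e·X)(∫e·Y)` format) and the centred triple product. [folklore] -/
theorem centred_split (hΓ : Γ.PosSemidef) (hΓop : (γop • (1 : Matrix ι ι ℝ) - Γ).PosSemidef) (Y : Finset ι)
    (hUd : ∀ φ : EuclideanSpace ℝ ι, HasFDerivAt U (U' φ) φ) (hU'd : ∀ φ : EuclideanSpace ℝ ι, HasFDerivAt U' (U'' φ) φ)
    (hU''d : ∀ φ : EuclideanSpace ℝ ι, HasFDerivAt U'' (U₃ φ) φ) (hU₃c : Continuous U₃) (hκ₀ : 0 ≤ κ₀) (hκ₁ : 0 ≤ κ₁) (ha : 0 ≤ a) (hτ : 0 < τ) (hδ :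
        0 < δ)
    (hθ0 : 0 < θp) (hθ1 : θp < 1) (hκθ : (2 * κ₀ * (1 + τ) + 4 * δ) * γop ≤ θp) (hstab : ∀ φ : EuclideanSpace ℝ ι, -(κ₀ * ∑ x ∈ Y, φ x ^ 2) ≤ U φ)
    (hU'b : ∀ φ : EuclideanSpace ℝ ι, ‖U' φ‖ ≤ κ₁ * (a + ∑ x ∈ Y, φ x ^ 2)) (hU''b : ∀ φ : EuclideanSpace ℝ ι, ‖U'' φ‖ ≤ κ₂)
    (hU₃b : ∀ φ : EuclideanSpace ℝ ι, ‖U₃ φ‖ ≤ κ₃) (ψ h k l : EuclideanSpace ℝ ι) :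
    (∫ ω : EuclideanSpace ℝ ι, exp (-U (ω + ψ)) ∂(multivariateGaussian 0 Γ))⁻¹ * (∫ ω : EuclideanSpace ℝ ι, exp (-U (ω +
        ψ)) * (U₃ (ω + ψ) h k l - (U' (ω + ψ) k - ((∫ ω : EuclideanSpace ℝ ι, exp (-U (ω + ψ)) ∂(multivariateGaussian 0 Γ))⁻¹ * (∫ ω : EuclideanSpace
            ℝ ι, exp (-U (ω +
        ψ)) * U' (ω + ψ) k ∂(multivariateGaussian 0 Γ)))) * U'' (ω + ψ) h l - U'' (ω + ψ) h k * (U' (ω + ψ) l - ((∫ ω : EuclideanSpace ℝ ι, exp (-U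
            (ω + ψ))
        ∂(multivariateGaussian 0 Γ))⁻¹ * (∫ ω : EuclideanSpace ℝ ι, exp (-U (ω + ψ)) * U' (ω + ψ) l ∂(multivariateGaussian 0 Γ)))) - (U' (ω + ψ) h -
            ((∫ ω :
        EuclideanSpace ℝ ι, exp (-U (ω + ψ)) ∂(multivariateGaussian 0 Γ))⁻¹ * (∫ ω : EuclideanSpace ℝ ι, exp (-U (ω + ψ)) * U' (ω + ψ) h
            ∂(multivariateGaussian 0 Γ))))
        * U'' (ω + ψ) k l + (U' (ω + ψ) h - ((∫ ω : EuclideanSpace ℝ ι, exp (-U (ω + ψ)) ∂(multivariateGaussian 0 Γ))⁻¹ * (∫ ω : EuclideanSpace ℝ ι,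
            exp (-U (ω + ψ)) * U'
        (ω + ψ) h ∂(multivariateGaussian 0 Γ)))) * (U' (ω + ψ) k - ((∫ ω : EuclideanSpace ℝ ι, exp (-U (ω + ψ)) ∂(multivariateGaussian 0 Γ))⁻¹ * (∫ ω
            : EuclideanSpace ℝ
        ι, exp (-U (ω + ψ)) * U' (ω + ψ) k ∂(multivariateGaussian 0 Γ)))) * (U' (ω + ψ) l - ((∫ ω : EuclideanSpace ℝ ι, exp (-U (ω + ψ))
            ∂(multivariateGaussian 0 Γ))⁻¹
        * (∫ ω : EuclideanSpace ℝ ι, exp (-U (ω + ψ)) * U' (ω + ψ) l ∂(multivariateGaussian 0 Γ))))) ∂(multivariateGaussian 0 Γ)) =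
      (∫ ω : EuclideanSpace ℝ ι, exp (-U (ω + ψ)) ∂(multivariateGaussian 0 Γ))⁻¹ * (∫ ω : EuclideanSpace ℝ ι, exp (-U (ω + ψ)) * U₃ (ω + ψ) h k l
          ∂(multivariateGaussian 0 Γ)) - ((∫ ω : EuclideanSpace ℝ ι, exp (-U (ω + ψ)) ∂(multivariateGaussian 0 Γ))⁻¹ * (∫ ω : EuclideanSpace ℝ ι, exp
          (-U (ω + ψ)) * (U'' (ω + ψ) h l * U' (ω + ψ) k) ∂(multivariateGaussian 0 Γ)) - ((∫ ω : EuclideanSpace ℝ ι, exp (-U (ω + ψ))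
          ∂(multivariateGaussian 0 Γ)) ^ 2)⁻¹ * ((∫ ω : EuclideanSpace ℝ ι, exp (-U (ω + ψ)) * U'' (ω + ψ) h l ∂(multivariateGaussian 0 Γ)) * (∫ ω :
          EuclideanSpace ℝ ι, exp (-U (ω + ψ)) * U' (ω + ψ) k ∂(multivariateGaussian 0 Γ)))) - ((∫ ω : EuclideanSpace ℝ ι, exp (-U (ω + ψ))
          ∂(multivariateGaussian 0 Γ))⁻¹ * (∫ ω : EuclideanSpace ℝ ι, exp (-U (ω + ψ)) * (U'' (ω + ψ) h k * U' (ω + ψ) l) ∂(multivariateGaussian 0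
          Γ)) - ((∫ ω : EuclideanSpace ℝ ι, exp (-U (ω + ψ)) ∂(multivariateGaussian 0 Γ)) ^ 2)⁻¹ * ((∫ ω : EuclideanSpace ℝ ι, exp (-U (ω + ψ)) * U''
          (ω + ψ) h k ∂(multivariateGaussian 0 Γ)) * (∫ ω : EuclideanSpace ℝ ι, exp (-U (ω + ψ)) * U' (ω + ψ) l ∂(multivariateGaussian 0 Γ)))) - ((∫
          ω : EuclideanSpace ℝ ι, exp (-U (ω + ψ)) ∂(multivariateGaussian 0 Γ))⁻¹ * (∫ ω : EuclideanSpace ℝ ι, exp (-U (ω + ψ)) * (U' (ω + ψ) h * U''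
          (ω + ψ) k l) ∂(multivariateGaussian 0 Γ)) - ((∫ ω : EuclideanSpace ℝ ι, exp (-U (ω + ψ)) ∂(multivariateGaussian 0 Γ)) ^ 2)⁻¹ * ((∫ ω :
          EuclideanSpace ℝ ι, exp (-U (ω + ψ)) * U' (ω + ψ) h ∂(multivariateGaussian 0 Γ)) * (∫ ω : EuclideanSpace ℝ ι, exp (-U (ω + ψ)) * U'' (ω +
          ψ) k l ∂(multivariateGaussian 0 Γ)))) + (∫ ω : EuclideanSpace ℝ ι, exp (-U (ω + ψ)) ∂(multivariateGaussian 0 Γ))⁻¹ * (∫ ω : EuclideanSpace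
          ℝ ι, exp (-U (ω + ψ)) * ((U' (ω + ψ) h - ((∫ ω : EuclideanSpace ℝ ι, exp (-U (ω + ψ)) ∂(multivariateGaussian 0 Γ))⁻¹ * (∫ ω :
          EuclideanSpace ℝ ι, exp (-U (ω + ψ)) * U' (ω + ψ) h ∂(multivariateGaussian 0 Γ)))) * (U' (ω + ψ) k - ((∫ ω : EuclideanSpace ℝ ι, exp (-U (ω
          + ψ)) ∂(multivariateGaussian 0 Γ))⁻¹ * (∫ ω : EuclideanSpace ℝ ι, exp (-U (ω + ψ)) * U' (ω + ψ) k ∂(multivariateGaussian 0 Γ)))) * (U' (ω +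
          ψ) l - ((∫ ω : EuclideanSpace ℝ ι, exp (-U (ω + ψ)) ∂(multivariateGaussian 0 Γ))⁻¹ * (∫ ω : EuclideanSpace ℝ ι, exp (-U (ω + ψ)) * U' (ω +
          ψ) l ∂(multivariateGaussian 0 Γ))))) ∂(multivariateGaussian 0 Γ)) := by
  have hU'c : Continuous U' := continuous_iff_continuousAt.2 fun φ => (hU'd φ).continuousAt
  obtain ⟨iC, iB, iAB, iBA, -, -⟩ := integrable_scalar_pieces hΓ hΓop Y hUd hU'd hU''d hU₃c hκ₀ hκ₁ ha hτ hδ hθ0 hθ1 hκθ hstab hU'b hU''b hU₃b ψ h k l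
  set Zi : ℝ := (∫ ω : EuclideanSpace ℝ ι, exp (-U (ω + ψ)) ∂(multivariateGaussian 0 Γ))⁻¹ with hZi
  set ah : ℝ := Zi * (∫ ω : EuclideanSpace ℝ ι, exp (-U (ω + ψ)) * U' (ω + ψ) h ∂(multivariateGaussian 0 Γ)) with hah
  set ak : ℝ := Zi * (∫ ω : EuclideanSpace ℝ ι, exp (-U (ω + ψ)) * U' (ω + ψ) k ∂(multivariateGaussian 0 Γ)) with hak
  set al : ℝ := Zi * (∫ ω : EuclideanSpace ℝ ι, exp (-U (ω + ψ)) * U' (ω + ψ) l ∂(multivariateGaussian 0 Γ)) with hal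
  have iP := integrable_centred_triple hΓ hΓop Y hUd hU'd hU''d hU₃c hκ₀ hκ₁ ha hτ hδ hθ0 hθ1 hκθ hstab hU'b hU''b hU₃b ψ h k l ah ak al
  -- pointwise: the centred integrand as a combination of the five integrands
  have e1 : ∀ ω : EuclideanSpace ℝ ι, exp (-U (ω + ψ)) * (U₃ (ω + ψ) h k l - (U' (ω + ψ) k - ak) * U'' (ω + ψ) h l - U'' (ω + ψ) h k * (U' (ω + ψ) l
      - al) -
      (U' (ω + ψ) h - ah) * U'' (ω + ψ) k l + (U' (ω + ψ) h - ah) * (U' (ω + ψ) k - ak) * (U' (ω + ψ) l - al)) =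
      exp (-U (ω + ψ)) * U₃ (ω + ψ) h k l - (exp (-U (ω + ψ)) * (U'' (ω + ψ) h l * U' (ω + ψ) k) - ak * (exp (-U (ω + ψ)) * U'' (ω + ψ) h l)) -
        (exp (-U (ω + ψ)) * (U'' (ω + ψ) h k * U' (ω + ψ) l) - al * (exp (-U (ω + ψ)) * U'' (ω + ψ) h k)) -
        (exp (-U (ω + ψ)) * (U' (ω + ψ) h * U'' (ω + ψ) k l) - ah * (exp (-U (ω + ψ)) * U'' (ω + ψ) k l)) +
        exp (-U (ω + ψ)) * ((U' (ω + ψ) h - ah) * (U' (ω + ψ) k - ak) * (U' (ω + ψ) l - al)) := fun ω => by ring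
  simp_rw [e1]
  have g2 : Integrable (fun ω : EuclideanSpace ℝ ι => exp (-U (ω + ψ)) * (U'' (ω + ψ) h l * U' (ω + ψ) k) - ak * (exp (-U (ω + ψ)) * U'' (ω + ψ) h
      l)) (multivariateGaussian
      0 Γ) := (iBA h l k).sub ((iB h l).const_mul ak)
  have g3 : Integrable (fun ω : EuclideanSpace ℝ ι => exp (-U (ω + ψ)) * (U'' (ω + ψ) h k * U' (ω + ψ) l) - al * (exp (-U (ω + ψ)) * U'' (ω + ψ) h
      k)) (multivariateGaussian
      0 Γ) := (iBA h k l).sub ((iB h k).const_mul al)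
  have g4 : Integrable (fun ω : EuclideanSpace ℝ ι => exp (-U (ω + ψ)) * (U' (ω + ψ) h * U'' (ω + ψ) k l) - ah * (exp (-U (ω + ψ)) * U'' (ω + ψ) k
      l)) (multivariateGaussian
      0 Γ) := (iAB h k l).sub ((iB k l).const_mul ah)
  have t1 : Integrable (fun ω : EuclideanSpace ℝ ι => exp (-U (ω + ψ)) * U₃ (ω + ψ) h k l - (exp (-U (ω + ψ)) * (U'' (ω + ψ) h l * U' (ω + ψ) k) - ak
      * (exp (-U (ω + ψ)) *
      U'' (ω + ψ) h l))) (multivariateGaussian 0 Γ) := iC.sub g2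
  have t2 : Integrable (fun ω : EuclideanSpace ℝ ι => exp (-U (ω + ψ)) * U₃ (ω + ψ) h k l - (exp (-U (ω + ψ)) * (U'' (ω + ψ) h l * U' (ω + ψ) k) - ak
      * (exp (-U (ω + ψ)) *
      U'' (ω + ψ) h l)) - (exp (-U (ω + ψ)) * (U'' (ω + ψ) h k * U' (ω + ψ) l) - al * (exp (-U (ω + ψ)) * U'' (ω + ψ) h k))) (multivariateGaussian 0
          Γ) := t1.sub g3
  have t3 : Integrable (fun ω : EuclideanSpace ℝ ι => exp (-U (ω + ψ)) * U₃ (ω + ψ) h k l - (exp (-U (ω + ψ)) * (U'' (ω + ψ) h l * U' (ω + ψ) k) - ak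
      * (exp (-U (ω + ψ)) *
      U'' (ω + ψ) h l)) - (exp (-U (ω + ψ)) * (U'' (ω + ψ) h k * U' (ω + ψ) l) - al * (exp (-U (ω + ψ)) * U'' (ω + ψ) h k)) - (exp (-U (ω + ψ)) * (U'
          (ω + ψ) h * U'' (ω +
      ψ) k l) - ah * (exp (-U (ω + ψ)) * U'' (ω + ψ) k l))) (multivariateGaussian 0 Γ) := t2.sub g4
  rw [integral_add t3 iP, integral_sub t2 g4, integral_sub t1 g3, integral_sub iC g2, integral_sub (iBA h l k) ((iB h l).const_mul ak),
    integral_sub (iBA h k l) ((iB h k).const_mul al), integral_sub (iAB h k l) ((iB k l).const_mul ah)]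
  simp only [integral_const_mul]
  rw [hah, hak, hal, hZi]
  ring

end Split

/-! ## §2. Toy -/

/-- Toy (§1's algebra): centring one factor, `e·(A−a)B = e·BA − a·(e·B)`. -/
example (e A a B : ℝ) : e * ((A - a) * B) = e * (B * A) - a * (e * B) := by ring

end Summit.QuantumFields.BalabanUV.T4Continuum.NE7b.SupBlockThirdCentredSplit

end
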